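import Summits.CriticalPhenomena.PercolationContinuityZ3.Theorems.Transplant.PlanarCells2Contain
import Literature.Probability.Percolation.KozmaNitzanSteps
import HarnessLib

/-!
# Two-unit planar cells `PCells2` (layer L1′ of route D″ v2), part 4: levels along a macro-direction (unit `r∥ = r (δ.1)`), the level data
# of `Q / E^far / H / H^j / F^j / M_{v+δ}` and of the narrow boxes, the enlarged face row inside `farAN`, and the planar bounds
# (anisotropic boxes `cen + [±n r₀] × [±n r₁]` and their one-unit ENVELOPES `Λ_{n·rmax}`)

builds on p205010 (kernel theorem, internal audit signed; external expert review pending) — nothing in this file uses p205010.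
Lane `prim-bschramm`, seat `prim-hp-8` (gen 28; `HOME/bschramm/DPRIME-SCOPE.md` §2 L1′ + addendum B, lead VERDICT V98, design-owner
rulings R2 / F-flag "rectPrism envelope"); helper file (`--supports stmt-CriticalPhenomena-4575 --as helper`).  Continues
`PlanarCells2Defs` / `PlanarCells2Contain`; the proofs are the one-unit proofs of `PlanarCellsPSep2` / `PlanarCellsNarrowDefs` read
coordinatewise.
* `lev_adj`, `lev_le_lev_add_one_of_abs_sub_le_one` (levels move by `≤ 1` along a lattice edge / a `lip` edge); `lev_le_of_mem_Q`,
  `lev_ge_of_mem_Efar`, `lev_le_of_mem_Hfull_of_not_past`, `mem_Stub_of_mem_Hfull`, `mem_Face_of_mem_Hfull`, `lev_ge_of_mem_M_add`,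
  `lev_le_of_mem_Hfull`; narrow: `lev_ge_of_mem_EfarN`, `lev_le_of_mem_Hfull_of_not_past_EfarN`, `mem_EfarN_of_mem_Hfull`,
  `mem_farAN_of_mem_Hfull`, `lev_le_of_mem_Hfull_not_EfarN'`, `Face_far_EfarN'`;
* `Face_enlarge_subset_farAN` — the `k`-enlarged face row `F^{j+1} + [−k,k]²` lies in `farAN x du j` when `k + 2 ≤ 10 s∥` AND
  `k + 1 ≤ 3 r⊥` (two units: the transverse room `2r⊥ + k ≤ 5r⊥ − 1` is no longer implied by the level room);
* planar bounds: `sub_cen_le_of_mem_EwvN` (`|t_i − cen(w+δ)_i| ≤ 35 r_i`), `EfarN_subset_abox` / `farAN_subset_abox` / `BtwN_subset_abox_tgt`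
  (inside `cen + [±25r₀]×[±25r₁]`), and the square envelopes `abox_subset_box_image` (`cen v + [±n r₀]×[±n r₁] ⊆ cen v + Λ_{n·rmax}`),
  `EfarN_subset_box_image`, `farAN_subset_box_image`, `BtwN_subset_box_image_tgt`, `Q_subset_box_image`, `Hfull_subset_box_image`.
[cite: KozmaNitzan2024, §4 pp. 26, 30 — the ℤ^d model, one unit]
-/

noncomputable section

namespace Summit.CriticalPhenomena.PercolationContinuityZ3.Theorems

namespace Transplant

open Literature.Probability.Percolation Literature.Probability.LatticeModels SimpleGraph GadgetSystem Contour
open Literature.Probability.Percolation.KozmaNitzan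
open Literature.Probability.Percolation.KozmaNitzan.Cells (oth oth_ne sgOf sgOf_sign stepVec_apply_fst stepVec_apply_oth eq_oth_of_ne oth_oth
  eq_of_coords)
open PCells (mem_psBox_iff)

namespace PCells2

variable (P : PCells2)

/-! ## Levels -/

/-- The level, unfolded. [folklore] -/
theorem lev_def (δ : MDir) (v t : Site 2) : P.lev δ v t = sgOf δ * (t δ.1 - P.cen v δ.1) := rfl

/-- A lattice step changes the level by at most one. [folklore] -/
theorem lev_adj (δ : MDir) (v : Site 2) {t t' : Site 2} (h : (zdGraph 2).Adj t t') :
    P.lev δ v t' = P.lev δ v t ∨ P.lev δ v t' = P.lev δ v t + 1 ∨ P.lev δ v t' = P.lev δ v t - 1 := by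
  unfold lev
  rcases level_adj (a := δ.1) (sgOf_sign δ) (P.cen v) h with ⟨h1, -⟩ | ⟨h1, -⟩
  · exact Or.inl h1
  · rcases h1 with h1 | h1
    · exact Or.inr (Or.inl h1)
    · exact Or.inr (Or.inr h1)

/-- **Levels move by at most one along any step that moves the planar coordinates by at most one** (the `lip` form of `lev_adj`, for
skeletons with diagonal edges). [folklore] -/
theorem lev_le_lev_add_one_of_abs_sub_le_one {δ : MDir} (v : Site 2) {t t' : Site 2} (h : |t' δ.1 - t δ.1| ≤ 1) :
    P.lev δ v t' ≤ P.lev δ v t + 1 := by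
  unfold lev
  rw [abs_le] at h
  rcases sgOf_sign δ with hs | hs <;> rw [hs] <;> omega

/-- Points of `Q_v` have level at most `5r∥`. [folklore] -/
theorem lev_le_of_mem_Q {δ : MDir} {v t : Site 2} (ht : t ∈ P.Q v) : P.lev δ v t ≤ 5 * P.r δ.1 := by
  rw [Q, mem_abox_iff] at ht
  have h := ht δ.1; push_cast at h
  unfold lev; rcases sgOf_sign δ with hs | hs <;> rw [hs] <;> omega

/-- Points of `Q_v` have level at least `−5r∥`. [folklore] -/
theorem neg_le_lev_of_mem_Q {δ : MDir} {v t : Site 2} (ht : t ∈ P.Q v) : -(5 * (P.r δ.1 : ℤ)) ≤ P.lev δ v t := by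
  rw [Q, mem_abox_iff] at ht
  have h := ht δ.1; push_cast at h
  unfold lev; rcases sgOf_sign δ with hs | hs <;> rw [hs] <;> omega

/-- Points of `E^far_{v,δ}` have level at least `5r∥ + 1`. [folklore] -/
theorem lev_ge_of_mem_Efar {δ : MDir} {v t : Site 2} (ht : t ∈ P.Efar v δ) : 5 * (P.r δ.1 : ℤ) + 1 ≤ P.lev δ v t := by
  rw [Efar, mem_psBox_iff] at ht; exact ht.1.1

/-- Points of `E^far_{v,δ}` have level at most `25r∥`. [folklore] -/
theorem lev_le_of_mem_Efar {δ : MDir} {v t : Site 2} (ht : t ∈ P.Efar v δ) : P.lev δ v t ≤ 25 * P.r δ.1 := by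
  rw [Efar, mem_psBox_iff] at ht; exact ht.1.2

/-- Points of the corridor `H_{v,δ}` have level in `[5r∥, 22r∥]`. [folklore] -/
theorem lev_mem_of_mem_Hfull {δ : MDir} {v t : Site 2} (ht : t ∈ P.Hfull v δ) : 5 * (P.r δ.1 : ℤ) ≤ P.lev δ v t ∧ P.lev δ v t ≤ 22 * P.r δ.1 := by
  rw [Hfull, mem_psBox_iff] at ht; exact ht.1

/-- A point of the corridor `H_{v,δ}` NOT of level `> L` inside `E^far` has level `≤ L` (`5r∥ ≤ L`). [folklore] -/
theorem lev_le_of_mem_Hfull_of_not_past {δ : MDir} {v t : Site 2} (ht : t ∈ P.Hfull v δ) {L : ℤ} (hL : 5 * (P.r δ.1 : ℤ) ≤ L)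
    (hn : ¬(t ∈ P.Efar v δ ∧ L + 1 ≤ P.lev δ v t)) : P.lev δ v t ≤ L := by
  by_contra hlt
  push Not at hlt
  apply hn
  rw [Hfull, mem_psBox_iff] at ht
  refine ⟨?_, by omega⟩
  rw [Efar, mem_psBox_iff]
  unfold lev at hlt
  exact ⟨⟨by omega, by omega⟩, by omega, by omega⟩

/-- A corridor point of level `≤ 5r∥ + 10s∥j` lies in the stub `H^j`. [folklore] -/
theorem mem_Stub_of_mem_Hfull {δ : MDir} {v t : Site 2} (ht : t ∈ P.Hfull v δ) {j : ℕ} (hl : P.lev δ v t ≤ 5 * P.r δ.1 + 10 * P.s δ.1 * j) :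
    t ∈ P.Stub v δ j := by
  rw [Hfull, mem_psBox_iff] at ht
  rw [Stub, mem_psBox_iff]
  unfold lev at hl
  exact ⟨⟨ht.1.1, hl⟩, ht.2⟩

/-- A corridor point of level exactly `5r∥ + 10s∥j` lies on the face `F^j`. [folklore] -/
theorem mem_Face_of_mem_Hfull {δ : MDir} {v t : Site 2} (ht : t ∈ P.Hfull v δ) {j : ℕ} (hl : P.lev δ v t = 5 * P.r δ.1 + 10 * P.s δ.1 * j) :
    t ∈ P.Face v δ j := by
  rw [Hfull, mem_psBox_iff] at ht
  rw [Face, mem_psBox_iff]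
  unfold lev at hl
  exact ⟨⟨hl.ge, hl.le⟩, ht.2⟩

/-- Points of the stub `H^j` have level in `[5r∥, 5r∥ + 10 s∥ j]`. [folklore] -/
theorem lev_mem_of_mem_Stub {δ : MDir} {v t : Site 2} {j : ℕ} (ht : t ∈ P.Stub v δ j) :
    5 * (P.r δ.1 : ℤ) ≤ P.lev δ v t ∧ P.lev δ v t ≤ 5 * P.r δ.1 + 10 * P.s δ.1 * j := by
  rw [Stub, mem_psBox_iff] at ht; exact ht.1

/-- Points of the face `F^j` have level exactly `5r∥ + 10 s∥ j`. [folklore] -/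
theorem lev_eq_of_mem_Face {δ : MDir} {v t : Site 2} {j : ℕ} (ht : t ∈ P.Face v δ j) : P.lev δ v t = 5 * P.r δ.1 + 10 * P.s δ.1 * j := by
  rw [Face, mem_psBox_iff] at ht; unfold lev; exact le_antisymm ht.1.2 ht.1.1

/-- Points of `M_{v+δ}` have level at least `17 r∥`. [folklore] -/
theorem lev_ge_of_mem_M_add {δ : MDir} {v t : Site 2} (ht : t ∈ P.M (v + stepVec δ)) : 17 * (P.r δ.1 : ℤ) ≤ P.lev δ v t := by
  rw [M, mem_abox_iff] at ht
  have h := ht δ.1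
  rw [P.cen_add_stepVec_fst] at h
  push_cast at h
  unfold lev; rcases sgOf_sign δ with hs | hs <;> rw [hs] at h ⊢ <;> omega

/-- Points of `M_{v+δ}` have level at most `23 r∥`. [folklore] -/
theorem lev_le_of_mem_M_add {δ : MDir} {v t : Site 2} (ht : t ∈ P.M (v + stepVec δ)) : P.lev δ v t ≤ 23 * P.r δ.1 := by
  rw [M, mem_abox_iff] at ht
  have h := ht δ.1
  rw [P.cen_add_stepVec_fst] at h
  push_cast at h
  unfold lev; rcases sgOf_sign δ with hs | hs <;> rw [hs] at h ⊢ <;> omega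

/-- The level from the target, seen from the source: `lev δ v t = lev δ (v+δ) t + 20 r∥`. [folklore] -/
theorem lev_eq_lev_add_stepVec (δ : MDir) (v t : Site 2) : P.lev δ v t = P.lev δ (v + stepVec δ) t + 20 * P.r δ.1 := by
  unfold lev
  rw [P.cen_add_stepVec_fst]
  rcases sgOf_sign δ with hs | hs <;> rw [hs] <;> ring

/-! ### The narrow boxes -/

/-- Points of `EfarN_{v,δ}` have level at least `5r∥ + 1`. [folklore] -/
theorem lev_ge_of_mem_EfarN {δ : MDir} {v t : Site 2} (ht : t ∈ P.EfarN v δ) : 5 * (P.r δ.1 : ℤ) + 1 ≤ P.lev δ v t := by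
  rw [EfarN, mem_psBox_iff] at ht; exact ht.1.1

/-- A point of the corridor `H_{v,δ}` NOT of level `> L` inside `EfarN` has level `≤ L` (`5r∥ ≤ L`). [folklore] -/
theorem lev_le_of_mem_Hfull_of_not_past_EfarN {δ : MDir} {v t : Site 2} (ht : t ∈ P.Hfull v δ) {L : ℤ} (hL : 5 * (P.r δ.1 : ℤ) ≤ L)
    (hn : ¬(t ∈ P.EfarN v δ ∧ L + 1 ≤ P.lev δ v t)) : P.lev δ v t ≤ L := by
  by_contra hlt
  push Not at hlt
  apply hn
  rw [Hfull, mem_psBox_iff] at ht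
  refine ⟨?_, by omega⟩
  rw [EfarN, mem_psBox_iff]
  unfold lev at hlt
  have := P.one_le_r (oth δ.1)
  exact ⟨⟨by omega, by omega⟩, by omega, by omega⟩

/-- A corridor point of level `≥ 5r∥ + 1` lies in the narrow far region (corridor half-width `2r⊥ ≤ 5r⊥ − 1`). [folklore] -/
theorem mem_EfarN_of_mem_Hfull {δ : MDir} {v t : Site 2} (ht : t ∈ P.Hfull v δ) (hl : 5 * (P.r δ.1 : ℤ) + 1 ≤ P.lev δ v t) :
    t ∈ P.EfarN v δ := by
  rw [Hfull, mem_psBox_iff] at ht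
  rw [EfarN, mem_psBox_iff]
  unfold lev at hl
  have := P.one_le_r (oth δ.1)
  exact ⟨⟨hl, by omega⟩, by omega, by omega⟩

/-- A corridor point of level `≥ 5r∥ + 10 s∥ j + 1` lies in the narrow fresh rows `farAN x du j`. [folklore] -/
theorem mem_farAN_of_mem_Hfull {du : MDir} {x t : Site 2} (ht : t ∈ P.Hfull x du) {j : ℕ}
    (hl : 5 * (P.r du.1 : ℤ) + 10 * P.s du.1 * j + 1 ≤ P.lev du x t) : t ∈ P.farAN x du j := by
  rw [Hfull, mem_psBox_iff] at ht
  rw [farAN, mem_psBox_iff]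
  unfold lev at hl
  have := P.one_le_r (oth du.1)
  exact ⟨⟨hl, by omega⟩, by omega, by omega⟩

/-- A corridor point off the narrow far region has level `≤ 5r∥`. [folklore] -/
theorem lev_le_of_mem_Hfull_not_EfarN' {δ : MDir} {v t : Site 2} (ht : t ∈ P.Hfull v δ) (hn : t ∉ P.EfarN v δ) :
    P.lev δ v t ≤ 5 * P.r δ.1 :=
  P.lev_le_of_mem_Hfull_of_not_past_EfarN ht le_rfl fun h => hn h.1

/-- `F^{j+1}` lies in the narrow far region, beyond level `5r∥ + 10s∥j` (`j + 1 ≤ K`). [folklore] -/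
theorem Face_far_EfarN' {δ : MDir} {v t : Site 2} {j : ℕ} (hjK : j + 1 ≤ P.K) (ht : t ∈ P.Face v δ (j + 1)) :
    t ∈ P.EfarN v δ ∧ 5 * (P.r δ.1 : ℤ) + 10 * P.s δ.1 * j + 1 ≤ P.lev δ v t := by
  rw [Face, mem_psBox_iff] at ht
  have hs1 : (1 : ℤ) ≤ P.s δ.1 := by exact_mod_cast P.hs δ.1
  have hr1 : (1 : ℤ) ≤ P.r (oth δ.1) := by exact_mod_cast P.one_le_r (oth δ.1)
  have hrK := P.r_eq δ.1
  have hjK' : (j : ℤ) + 1 ≤ P.K := by exact_mod_cast hjK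
  have hb : 10 * (P.s δ.1 : ℤ) * (j + 1) ≤ 10 * P.s δ.1 * P.K := mul_le_mul_of_nonneg_left hjK' (by positivity)
  push_cast at ht
  refine ⟨?_, by unfold lev; nlinarith [ht.1.1]⟩
  rw [EfarN, mem_psBox_iff]
  exact ⟨⟨by nlinarith [ht.1.1], by nlinarith [ht.1.2]⟩, by omega, by omega⟩

/-! ## The enlarged face row -/

/-- **The `k`-enlargement of the face row `F^{j+1}` lies in `farAN`** when `j + 1 ≤ K`, `k + 2 ≤ 10 s∥` (level room below and above) and
`k + 1 ≤ 3 r⊥` (transverse room `2r⊥ + k ≤ 5r⊥ − 1`; with one unit this followed from `k ≤ 10s − 2 ≤ r/2`, with two units it is a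
separate hypothesis). [cite: KozmaNitzan2024, §4 p. 30 (the levels above F^{j+1})] -/
theorem Face_enlarge_subset_farAN (x : Site 2) (du : MDir) {j k : ℕ} (hj : j + 1 ≤ P.K) (hk : k + 2 ≤ 10 * P.s du.1)
    (hk' : k + 1 ≤ 3 * P.r (oth du.1)) :
    Finset.Icc (P.faceLo x du j - (k : Site 2)) (P.faceHi x du j + (k : Site 2)) ⊆ P.farAN x du j := by
  rw [faceLo, faceHi, sBox_enlarge _ _ (sgOf_sign du), farAN]
  have hsj : (P.s du.1 : ℤ) * (j + 1) ≤ P.r du.1 := by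
    have h := Nat.mul_le_mul_left (P.s du.1) hj
    rw [Nat.mul_comm (P.s du.1) P.K] at h
    exact_mod_cast (show P.s du.1 * (j + 1) ≤ P.r du.1 from h)
  have h20 := P.twenty_mul_s_le_r du.1
  unfold faceL
  refine sBox_mono (sgOf_sign du) _ ?_ ?_ ?_ <;> push_cast <;> nlinarith [P.one_le_r du.1, P.hs du.1]

/-- The face row `F^{j+1}` itself (the `0`-enlargement) lies in `farAS x du j` when `j + 1 ≤ K` (levels: `5r∥+10s∥j+2 ≤ faceL ≤ 25r∥−1`
as `10 s∥ ≥ 3`; transversally `2r⊥ ≤ 5r⊥ − 2`). [cite: KozmaNitzan2024, §4 p. 30] -/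
theorem faceRow_subset_farAS (x : Site 2) (du : MDir) {j : ℕ} (hj : j + 1 ≤ P.K) :
    Finset.Icc (P.faceLo x du j) (P.faceHi x du j) ⊆ P.farAS x du j := by
  rw [Icc_faceLo_faceHi, farAS]
  have hsj : (P.s du.1 : ℤ) * (j + 1) ≤ P.r du.1 := by
    have h := Nat.mul_le_mul_left (P.s du.1) hj
    rw [Nat.mul_comm (P.s du.1) P.K] at h
    exact_mod_cast (show P.s du.1 * (j + 1) ≤ P.r du.1 from h)
  unfold faceL
  refine sBox_mono (sgOf_sign du) _ ?_ ?_ ?_ <;> push_cast <;> nlinarith [P.one_le_r du.1, P.hs du.1, P.one_le_r (oth du.1)]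

/-! ## Planar bounds -/

/-- A crude planar bound: a point of `EwvN_{w,δ}` is within `35 r_i` of the centre of `w + δ` in coordinate `i`. [folklore] -/
theorem sub_cen_le_of_mem_EwvN {w : Site 2} {δ : MDir} {t : Site 2} (ht : t ∈ P.EwvN w δ) (i : Fin 2) :
    |t i - P.cen (w + stepVec δ) i| ≤ 35 * P.r i := by
  rw [EwvN, Finset.mem_union] at ht
  have hf := P.cen_add_stepVec_fst w δ
  have ho := P.cen_add_stepVec_oth w δ
  rw [abs_le]
  rcases ht with ht | ht
  · rw [BtwN, mem_psBox_iff] at ht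
    obtain ⟨⟨h1, h2⟩, h3, h4⟩ := ht
    rcases eq_or_ne i δ.1 with rfl | hi
    · have hr1 : (1 : ℤ) ≤ P.r δ.1 := by exact_mod_cast P.one_le_r δ.1
      rw [hf]; rcases sgOf_sign δ with hs | hs <;> rw [hs] at h1 h2 ⊢ <;> constructor <;> nlinarith
    · have hr1 : (1 : ℤ) ≤ P.r (oth δ.1) := by exact_mod_cast P.one_le_r (oth δ.1)
      rw [eq_oth_of_ne hi, ho]; constructor <;> linarith
  · rw [Q, mem_abox_iff] at ht
    have hr1 : (0 : ℤ) ≤ P.r i := by positivity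
    have := ht i; push_cast at this; constructor <;> linarith

/-- **Envelope**: the anisotropic box `c + [±n r₀] × [±n r₁]` lies in the square `c + Λ_{n·rmax}`. [folklore] -/
theorem abox_subset_box_image (c : Site 2) (n : ℕ) :
    Finset.Icc (c - P.hw n) (c + P.hw n) ⊆ (box 2 (n * P.rmax)).image (fun s => s + c) := by
  intro t ht
  rw [mem_Icc_iff] at ht
  refine Finset.mem_image.2 ⟨t - c, ?_, by abel⟩
  rw [mem_box]
  intro i
  have h := ht i
  simp only [Pi.sub_apply, Pi.add_apply, hw_apply] at h ⊢
  have hm : n * P.r i ≤ n * P.rmax := Nat.mul_le_mul_left _ (P.r_le_rmax i)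
  push_cast at h hm ⊢
  constructor <;> linarith [h.1, h.2]

/-- `Q v ⊆ cen v + Λ_{5·rmax}`. [folklore] -/
theorem Q_subset_box_image (v : Site 2) : P.Q v ⊆ (box 2 (5 * P.rmax)).image (fun s => s + P.cen v) :=
  P.abox_subset_box_image (P.cen v) 5

/-- `Cell v ⊆ cen v + Λ_{10·rmax}`. [folklore] -/
theorem Cell_subset_box_image (v : Site 2) : P.Cell v ⊆ (box 2 (10 * P.rmax)).image (fun s => s + P.cen v) :=
  P.abox_subset_box_image (P.cen v) 10

/-- `EfarN(x, du) ⊆ cen x + [±25r₀] × [±25r₁]`. [folklore] -/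
theorem EfarN_subset_abox (x : Site 2) (du : MDir) : P.EfarN x du ⊆ Finset.Icc (P.cen x - P.hw 25) (P.cen x + P.hw 25) := by
  intro t ht
  rw [EfarN, mem_psBox_iff] at ht
  rw [mem_abox_iff]
  intro i
  push_cast
  by_cases hi : i = du.1
  · subst hi
    rcases sgOf_sign du with hs | hs <;> rw [hs] at ht <;> constructor <;> nlinarith [ht.1.1, ht.1.2, P.one_le_r du.1]
  · rw [eq_oth_of_ne hi]; constructor <;> linarith [ht.2.1, ht.2.2, P.one_le_r (oth du.1)]

/-- `Efar(x, du) ⊆ cen x + [±25r₀] × [±25r₁]`. [folklore] -/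
theorem Efar_subset_abox (x : Site 2) (du : MDir) : P.Efar x du ⊆ Finset.Icc (P.cen x - P.hw 25) (P.cen x + P.hw 25) := by
  intro t ht
  rw [Efar, mem_psBox_iff] at ht
  rw [mem_abox_iff]
  intro i
  push_cast
  by_cases hi : i = du.1
  · subst hi
    rcases sgOf_sign du with hs | hs <;> rw [hs] at ht <;> constructor <;> nlinarith [ht.1.1, ht.1.2, P.one_le_r du.1]
  · rw [eq_oth_of_ne hi]; constructor <;> linarith [ht.2.1, ht.2.2, P.one_le_r (oth du.1)]

/-- `Hfull(x, du) ⊆ cen x + [±25r₀] × [±25r₁]`. [folklore] -/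
theorem Hfull_subset_abox (x : Site 2) (du : MDir) : P.Hfull x du ⊆ Finset.Icc (P.cen x - P.hw 25) (P.cen x + P.hw 25) := by
  intro t ht
  rw [Hfull, mem_psBox_iff] at ht
  rw [mem_abox_iff]
  intro i
  push_cast
  by_cases hi : i = du.1
  · subst hi
    rcases sgOf_sign du with hs | hs <;> rw [hs] at ht <;> constructor <;> nlinarith [ht.1.1, ht.1.2, P.one_le_r du.1]
  · rw [eq_oth_of_ne hi]; constructor <;> linarith [ht.2.1, ht.2.2, P.one_le_r (oth du.1)]

/-- `BtwN v δ ⊆ cen (v + δ) + [±25r₀] × [±25r₁]` (the narrow between-box seen from the target cell). [folklore] -/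
theorem BtwN_subset_abox_tgt (v : Site 2) (δ : MDir) :
    P.BtwN v δ ⊆ Finset.Icc (P.cen (v + stepVec δ) - P.hw 25) (P.cen (v + stepVec δ) + P.hw 25) := by
  intro t ht
  rw [BtwN, mem_psBox_iff] at ht
  rw [mem_abox_iff]
  intro i
  push_cast at ht ⊢
  by_cases hi : i = δ.1
  · subst hi
    rw [P.cen_add_stepVec_fst]
    rcases sgOf_sign δ with hs | hs <;> rw [hs] at ht ⊢ <;> constructor <;> nlinarith [ht.1.1, ht.1.2, P.one_le_r δ.1]
  · rw [eq_oth_of_ne hi, P.cen_add_stepVec_oth]; constructor <;> linarith [ht.2.1, ht.2.2, P.one_le_r (oth δ.1)]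

/-- `Btw v δ ⊆ cen (v + δ) + [±25r₀] × [±25r₁]`. [folklore] -/
theorem Btw_subset_abox_tgt (v : Site 2) (δ : MDir) :
    P.Btw v δ ⊆ Finset.Icc (P.cen (v + stepVec δ) - P.hw 25) (P.cen (v + stepVec δ) + P.hw 25) := by
  intro t ht
  rw [Btw, mem_psBox_iff] at ht
  rw [mem_abox_iff]
  intro i
  push_cast at ht ⊢
  by_cases hi : i = δ.1
  · subst hi
    rw [P.cen_add_stepVec_fst]
    rcases sgOf_sign δ with hs | hs <;> rw [hs] at ht ⊢ <;> constructor <;> nlinarith [ht.1.1, ht.1.2, P.one_le_r δ.1]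
  · rw [eq_oth_of_ne hi, P.cen_add_stepVec_oth]; constructor <;> linarith [ht.2.1, ht.2.2, P.one_le_r (oth δ.1)]

/-- `farAN(x, du, j) ⊆ cen x + [±25r₀] × [±25r₁]`. [folklore] -/
theorem farAN_subset_abox (x : Site 2) (du : MDir) (j : ℕ) : P.farAN x du j ⊆ Finset.Icc (P.cen x - P.hw 25) (P.cen x + P.hw 25) :=
  (P.farAN_subset_EfarN x du j).trans (P.EfarN_subset_abox x du)

/-- `EfarN(x, du) ⊆ cen x + Λ_{25·rmax}` (square envelope). [folklore] -/
theorem EfarN_subset_box_image (x : Site 2) (du : MDir) : P.EfarN x du ⊆ (box 2 (25 * P.rmax)).image (fun s => s + P.cen x) :=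
  (P.EfarN_subset_abox x du).trans (P.abox_subset_box_image (P.cen x) 25)

/-- `Efar(x, du) ⊆ cen x + Λ_{25·rmax}`. [folklore] -/
theorem Efar_subset_box_image (x : Site 2) (du : MDir) : P.Efar x du ⊆ (box 2 (25 * P.rmax)).image (fun s => s + P.cen x) :=
  (P.Efar_subset_abox x du).trans (P.abox_subset_box_image (P.cen x) 25)

/-- `Hfull(x, du) ⊆ cen x + Λ_{25·rmax}`. [folklore] -/
theorem Hfull_subset_box_image (x : Site 2) (du : MDir) : P.Hfull x du ⊆ (box 2 (25 * P.rmax)).image (fun s => s + P.cen x) :=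
  (P.Hfull_subset_abox x du).trans (P.abox_subset_box_image (P.cen x) 25)

/-- `BtwN v δ ⊆ cen (v + δ) + Λ_{25·rmax}`. [folklore] -/
theorem BtwN_subset_box_image_tgt (v : Site 2) (δ : MDir) :
    P.BtwN v δ ⊆ (box 2 (25 * P.rmax)).image (fun s => s + P.cen (v + stepVec δ)) :=
  (P.BtwN_subset_abox_tgt v δ).trans (P.abox_subset_box_image _ 25)

/-- `Btw v δ ⊆ cen (v + δ) + Λ_{25·rmax}`. [folklore] -/
theorem Btw_subset_box_image_tgt (v : Site 2) (δ : MDir) :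
    P.Btw v δ ⊆ (box 2 (25 * P.rmax)).image (fun s => s + P.cen (v + stepVec δ)) :=
  (P.Btw_subset_abox_tgt v δ).trans (P.abox_subset_box_image _ 25)

/-- `farAN(x, du, j) ⊆ cen x + Λ_{25·rmax}`. [folklore] -/
theorem farAN_subset_box_image (x : Site 2) (du : MDir) (j : ℕ) : P.farAN x du j ⊆ (box 2 (25 * P.rmax)).image (fun s => s + P.cen x) :=
  (P.farAN_subset_EfarN x du j).trans (P.EfarN_subset_box_image x du)

/-- `farAS(x, du, j) ⊆ cen x + Λ_{25·rmax}`. [folklore] -/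
theorem farAS_subset_box_image (x : Site 2) (du : MDir) (j : ℕ) : P.farAS x du j ⊆ (box 2 (25 * P.rmax)).image (fun s => s + P.cen x) :=
  (P.farAS_subset_farAN x du j).trans (P.farAN_subset_box_image x du j)

/-- `probeWorldN v δ du ⊆ cen (v + δ) + Λ_{25·rmax}`. [folklore] -/
theorem probeWorldN_subset_box_image (v : Site 2) (δ du : MDir) :
    P.probeWorldN v δ du ⊆ (box 2 (25 * P.rmax)).image (fun s => s + P.cen (v + stepVec δ)) := by
  rw [probeWorldN]
  refine Finset.union_subset (Finset.union_subset (P.BtwN_subset_box_image_tgt v δ) ?_) (P.Hfull_subset_box_image _ du)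
  exact (P.Q_subset_box_image _).trans (Finset.image_subset_image (box_mono 2 (Nat.mul_le_mul_right P.rmax (by norm_num))))

end PCells2

end Transplant

end Summit.CriticalPhenomena.PercolationContinuityZ3.Theorems

end
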